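import Summits.CriticalPhenomena.PercolationContinuityZ3.Theorems.PercNearOneGluingNoHeavyLowerTailHubPairTermGlue
import Summits.CriticalPhenomena.PercolationContinuityZ3.Theorems.PercNearOneGluingNoHeavyLowerTailApexTwoSumSums
import HarnessLib

/-!
# `NoHeavyLowerTail` (stmt-CriticalPhenomena-4575) — HUB PAIRS WITH A TERMINAL ALONE ON ITS SIDE, part 2 (measure level, every `q > 0`):
# the eight-state dictionary `K · Zφ(E_G) = Σ_s X_s · R_s(E)` for a terminal arm glued at `{h₀, h₁}`

Support file (prover prim-gen-kcluster gen 72; `--supports stmt-CriticalPhenomena-4575`).  No definitions, no named facts, no sorries.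
SETTING (part 1).  Supports `DX` (TERMINAL ARM: contains `c`, meets the near side only in the hubs `h₀ ≠ h₁`) and `DK` (NEAR SIDE, containing `a, b`);
`w` vanishing off `DX ∪ DK`, `wX = w·1_{DX}`, `wK = w·1_{DXᶜ}`; `T = {h₀, h₁}`, `K = q^{k^T(∅)}`.  ARM STATES (events on `ω ∩ DX`): the partition of
`{c, h₀, h₁}` — `A = {c h₀ h₁}`, `B = {c | h₀ h₁}`, `C = {c h₀ | h₁}`, `D = {c h₁ | h₀}` — and, for `{c | h₀ | h₁}`, the four values of the FLAGS
`N₀ = [C_X(h₀) separates h₁ from c in DX]`, `N₁` (states `E, F, G, H` = `¬N₀¬N₁, N₀¬N₁, ¬N₀N₁, N₀N₁`).  For events `E_G` (glued graph) and near-side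
events `F_s` with the REPLACEMENT PROPERTY `ω ∈ E_G ↔ ω_K⁺ ∈ F_s` in state `s` (`ω_K⁺ = insert h₀h₁ (ω ∖ DX)` in the joined states `A, B`, `ω ∖ DX`
otherwise; part 3 supplies the `F_s` of the four R1 cells):
* `HubPairTerm.pt` — `K · rcW(ω) 1_{E_G}(ω)` splits along the state of `ω ∩ DX`;
* `HubPairTerm.sum_eq` — `K · Zφ(E_G) = Σ_s X_s · R_s`, `X_s` the `T`-wired arm masses, `R_s = Σ_η rcW^T_{wK}(η) 1_{F_s}(η⁺)` (joined states) resp.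
  `Σ_η rcW^T_{wK}(η) 1_{F_s}(η) q^{[h₁ ∉ C_η(h₀)]}` (the others; = free near-side masses).
-/

noncomputable section

namespace Summit.CriticalPhenomena.PercolationContinuityZ3.Theorems

namespace HubPairTerm

open Finset SimpleGraph Literature.Probability.Percolation Literature.Probability.Percolation.Gladkov
open Literature.Probability.Percolation.BHK2006 (weight)
open Literature.Probability.Percolation.DecisionTree (ind ind_of_mem ind_of_not_mem ind_nonneg)
open Literature.Probability.LatticeModels RefinedRowR3 ThreePointLB APL MeasureTheory
open scoped Classical

variable {V : Type*} [Fintype V]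

section Pointwise

variable {DX DK : Finset (Sym2 V)} {h₀ h₁ c : V} (h01 : h₀ ≠ h₁)
  (hsepD : ∀ z : V, (∃ e ∈ DX, z ∈ e) → (∃ e ∈ DK, z ∈ e) → (z = h₀ ∨ z = h₁))
  (w : Sym2 V → unitInterval) (q : ℝ) (hw : ∀ e, e ∉ (↑DX ∪ ↑DK : Set (Sym2 V)) → (w e : ℝ) = 0)
include h01 hsepD hw

/-- **Pointwise dictionary** (eight arm states). [this work] -/
theorem pt {EG FA FB FC FD FE FF FG FH : Set (BondConfig V)}
    (hA : (∀ ω : BondConfig V, ω ⊆ ↑DX ∪ ↑DK → (ω ∩ ↑DX) ∈ {η : BondConfig V | c ∈ cl η.toFinset h₀ ∧ h₁ ∈ cl η.toFinset h₀} → (ω ∈ EG ↔ insert s(h₀, h₁) (ω \ ↑DX) ∈ FA))) (hB : (∀ ω : BondConfig V, ω ⊆ ↑DX ∪ ↑DK → (ω ∩ ↑DX) ∈ {η : BondConfig V | c ∉ cl η.toFinset h₀ ∧ h₁ ∈ cl η.toFinset h₀} → (ω ∈ EG ↔ insert s(h₀, h₁) (ω \ ↑DX) ∈ FB))) (hC :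 (∀ ω : BondConfig V, ω ⊆ ↑DX ∪ ↑DK → (ω ∩ ↑DX) ∈ {η : BondConfig V | c ∈ cl η.toFinset h₀ ∧ h₁ ∉ cl η.toFinset h₀} → (ω ∈ EG ↔ (ω \ ↑DX) ∈ FC))) (hD : (∀ ω : BondConfig V, ω ⊆ ↑DX ∪ ↑DK → (ω ∩ ↑DX) ∈ {η : BondConfig V | c ∉ cl η.toFinset h₀ ∧ h₁ ∉ cl η.toFinset h₀ ∧ h₁ ∈ cl η.toFinset c} → (ω ∈ EG ↔ (ω \ ↑DX) ∈ FD))) (hE : (∀ ω : BondConfig V, ω ⊆ ↑DX ∪ ↑DK → (ω ∩ ↑DX) ∈ {η : BondConfig V | c ∉ cl η.toFinset h₀ ∧ h₁ ∉ cl η.toFinset h₀ ∧ h₁ ∉ cl η.toFinset c ∧ ¬ Sep DX (cl η.toFinset h₀) c h₁ ∧ ¬ Sep DX (cl η.toFinset h₁) c h₀} → (ω ∈ EG ↔ (ω \ ↑DX) ∈ FE))) (hF : (∀ ω : BondConfig V, ω ⊆ ↑DX ∪ ↑DK → (ω ∩ ↑DX) ∈ {η : BondConfig V | c ∉ cl η.toFinset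 h₀ ∧ h₁ ∉ cl η.toFinset h₀ ∧ h₁ ∉ cl η.toFinset c ∧ Sep DX (cl η.toFinset h₀) c h₁ ∧ ¬ Sep DX (cl η.toFinset h₁) c h₀} → (ω ∈ EG ↔ (ω \ ↑DX) ∈ FF))) (hG : (∀ ω : BondConfig V, ω ⊆ ↑DX ∪ ↑DK → (ω ∩ ↑DX) ∈ {η : BondConfig V | c ∉ cl η.toFinset h₀ ∧ h₁ ∉ cl η.toFinset h₀ ∧ h₁ ∉ cl η.toFinset c ∧ ¬ Sep DX (cl η.toFinset h₀) c h₁ ∧ Sep DX (cl η.toFinset h₁) c h₀} → (ω ∈ EG ↔ (ω \ ↑DX) ∈ FG))) (hH : (∀ ω : BondConfig V, ω ⊆ ↑DX ∪ ↑DK → (ω ∩ ↑DX) ∈ {η : BondConfig V | c ∉ cl η.toFinset h₀ ∧ h₁ ∉ cl η.toFinset h₀ ∧ h₁ ∉ cl η.toFinset c ∧ Sep DX (cl η.toFinset h₀) c h₁ ∧ Sep DX (cl η.toFinset h₁) c h₀} → (ω ∈ EG ↔ (ω \ ↑DX) ∈ FH))) (ω : BondConfig V) :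
    rcWeightW w q ∅ ω * ind EG ω * q ^ clusterCount (∅ : BondConfig V) ({h₀, h₁} : Set V) =
      weight (fun e => (w e : ℝ)) ω *
        ((ind {η : BondConfig V | c ∈ cl η.toFinset h₀ ∧ h₁ ∈ cl η.toFinset h₀} (ω ∩ ↑DX) * q ^ clusterCount (ω ∩ ↑DX) ({h₀, h₁} : Set V)) *
            (ind {η : BondConfig V | insert s(h₀, h₁) η ∈ FA} (ω \ ↑DX) * q ^ clusterCount (ω \ ↑DX) ({h₀, h₁} : Set V)) +
          (ind {η : BondConfig V | c ∉ cl η.toFinset h₀ ∧ h₁ ∈ cl η.toFinset h₀} (ω ∩ ↑DX) * q ^ clusterCount (ω ∩ ↑DX) ({h₀, h₁} : Set V)) *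
            (ind {η : BondConfig V | insert s(h₀, h₁) η ∈ FB} (ω \ ↑DX) * q ^ clusterCount (ω \ ↑DX) ({h₀, h₁} : Set V)) +
          (ind {η : BondConfig V | c ∈ cl η.toFinset h₀ ∧ h₁ ∉ cl η.toFinset h₀} (ω ∩ ↑DX) * q ^ clusterCount (ω ∩ ↑DX) ({h₀, h₁} : Set V)) *
            ((ind FC (ω \ ↑DX) * (if (ω \ ↑DX) ∈ {η : BondConfig V | h₁ ∈ cl η.toFinset h₀} then 1 else q)) * q ^ clusterCount (ω \ ↑DX) ({h₀, h₁} : Set V)) +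
          (ind {η : BondConfig V | c ∉ cl η.toFinset h₀ ∧ h₁ ∉ cl η.toFinset h₀ ∧ h₁ ∈ cl η.toFinset c} (ω ∩ ↑DX) * q ^ clusterCount (ω ∩ ↑DX) ({h₀, h₁} : Set V)) *
            ((ind FD (ω \ ↑DX) * (if (ω \ ↑DX) ∈ {η : BondConfig V | h₁ ∈ cl η.toFinset h₀} then 1 else q)) * q ^ clusterCount (ω \ ↑DX) ({h₀, h₁} : Set V)) +
          (ind {η : BondConfig V | c ∉ cl η.toFinset h₀ ∧ h₁ ∉ cl η.toFinset h₀ ∧ h₁ ∉ cl η.toFinset c ∧ ¬ Sep DX (cl η.toFinset h₀) c h₁ ∧ ¬ Sep DX (cl η.toFinset h₁) c h₀} (ω ∩ ↑DX) * q ^ clusterCount (ω ∩ ↑DX) ({h₀, h₁} : Set V)) *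
            ((ind FE (ω \ ↑DX) * (if (ω \ ↑DX) ∈ {η : BondConfig V | h₁ ∈ cl η.toFinset h₀} then 1 else q)) * q ^ clusterCount (ω \ ↑DX) ({h₀, h₁} : Set V)) +
          (ind {η : BondConfig V | c ∉ cl η.toFinset h₀ ∧ h₁ ∉ cl η.toFinset h₀ ∧ h₁ ∉ cl η.toFinset c ∧ Sep DX (cl η.toFinset h₀) c h₁ ∧ ¬ Sep DX (cl η.toFinset h₁) c h₀} (ω ∩ ↑DX) * q ^ clusterCount (ω ∩ ↑DX) ({h₀, h₁} : Set V)) *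
            ((ind FF (ω \ ↑DX) * (if (ω \ ↑DX) ∈ {η : BondConfig V | h₁ ∈ cl η.toFinset h₀} then 1 else q)) * q ^ clusterCount (ω \ ↑DX) ({h₀, h₁} : Set V)) +
          (ind {η : BondConfig V | c ∉ cl η.toFinset h₀ ∧ h₁ ∉ cl η.toFinset h₀ ∧ h₁ ∉ cl η.toFinset c ∧ ¬ Sep DX (cl η.toFinset h₀) c h₁ ∧ Sep DX (cl η.toFinset h₁) c h₀} (ω ∩ ↑DX) * q ^ clusterCount (ω ∩ ↑DX) ({h₀, h₁} : Set V)) *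
            ((ind FG (ω \ ↑DX) * (if (ω \ ↑DX) ∈ {η : BondConfig V | h₁ ∈ cl η.toFinset h₀} then 1 else q)) * q ^ clusterCount (ω \ ↑DX) ({h₀, h₁} : Set V)) +
          (ind {η : BondConfig V | c ∉ cl η.toFinset h₀ ∧ h₁ ∉ cl η.toFinset h₀ ∧ h₁ ∉ cl η.toFinset c ∧ Sep DX (cl η.toFinset h₀) c h₁ ∧ Sep DX (cl η.toFinset h₁) c h₀} (ω ∩ ↑DX) * q ^ clusterCount (ω ∩ ↑DX) ({h₀, h₁} : Set V)) *
            ((ind FH (ω \ ↑DX) * (if (ω \ ↑DX) ∈ {η : BondConfig V | h₁ ∈ cl η.toFinset h₀} then 1 else q)) * q ^ clusterCount (ω \ ↑DX) ({h₀, h₁} : Set V))) := by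
  by_cases hω : ω ⊆ ↑DX ∪ ↑DK
  swap
  · obtain ⟨e, heω, heD⟩ := Set.not_subset.1 hω
    have h0 := ApexTwoSum.weight_eq_zero_of_mem_not_mem w hw heω heD
    unfold rcWeightW
    rw [h0]; ring
  have hadd := ApexTwoSum.kT_add hsepD hω
  have hglue := ApexTwoSum.glued_h_iff hsepD hω
  -- the two cluster-count regimes
  have powJ : h₁ ∈ cl ω.toFinset h₀ →
      q ^ clusterCount ω ∅ * q ^ clusterCount (∅ : BondConfig V) ({h₀, h₁} : Set V) = q ^ clusterCount (ω ∩ ↑DX) ({h₀, h₁} : Set V) * q ^ clusterCount (ω \ ↑DX) ({h₀, h₁} : Set V) := fun hvu => by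
    rw [← pow_add, ApexTwoSum.k_of_mem h01 ω hvu, hadd, pow_add]
  have powN : h₁ ∉ cl ω.toFinset h₀ →
      q ^ clusterCount ω ∅ * q ^ clusterCount (∅ : BondConfig V) ({h₀, h₁} : Set V) = q ^ clusterCount (ω ∩ ↑DX) ({h₀, h₁} : Set V) * q ^ clusterCount (ω \ ↑DX) ({h₀, h₁} : Set V) * q := fun hvu => by
    rw [ApexTwoSum.k_of_not_mem h01 ω hvu, pow_succ, mul_right_comm, ← pow_add, hadd, pow_add]
  -- abbreviations for the indicator bookkeeping
  by_cases c1 : (ω ∩ ↑DX) ∈ {η : BondConfig V | c ∈ cl η.toFinset h₀}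
  · by_cases hJ : (ω ∩ ↑DX) ∈ {η : BondConfig V | h₁ ∈ cl η.toFinset h₀}
    · -- state A
      have hS : (ω ∩ ↑DX) ∈ {η : BondConfig V | c ∈ cl η.toFinset h₀ ∧ h₁ ∈ cl η.toFinset h₀} := ⟨c1, hJ⟩
      have nB : (ω ∩ ↑DX) ∉ {η : BondConfig V | c ∉ cl η.toFinset h₀ ∧ h₁ ∈ cl η.toFinset h₀} := fun h => h.1 c1
      have nC : (ω ∩ ↑DX) ∉ {η : BondConfig V | c ∈ cl η.toFinset h₀ ∧ h₁ ∉ cl η.toFinset h₀} := fun h => h.2 hJ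
      have nD : (ω ∩ ↑DX) ∉ {η : BondConfig V | c ∉ cl η.toFinset h₀ ∧ h₁ ∉ cl η.toFinset h₀ ∧ h₁ ∈ cl η.toFinset c} := fun h => h.1 c1
      have nE : (ω ∩ ↑DX) ∉ {η : BondConfig V | c ∉ cl η.toFinset h₀ ∧ h₁ ∉ cl η.toFinset h₀ ∧ h₁ ∉ cl η.toFinset c ∧ ¬ Sep DX (cl η.toFinset h₀) c h₁ ∧ ¬ Sep DX (cl η.toFinset h₁) c h₀} := fun h => h.1 c1
      have nF : (ω ∩ ↑DX) ∉ {η : BondConfig V | c ∉ cl η.toFinset h₀ ∧ h₁ ∉ cl η.toFinset h₀ ∧ h₁ ∉ cl η.toFinset c ∧ Sep DX (cl η.toFinset h₀) c h₁ ∧ ¬ Sep DX (cl η.toFinset h₁) c h₀} := fun h => h.1 c1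
      have nG : (ω ∩ ↑DX) ∉ {η : BondConfig V | c ∉ cl η.toFinset h₀ ∧ h₁ ∉ cl η.toFinset h₀ ∧ h₁ ∉ cl η.toFinset c ∧ ¬ Sep DX (cl η.toFinset h₀) c h₁ ∧ Sep DX (cl η.toFinset h₁) c h₀} := fun h => h.1 c1
      have nH : (ω ∩ ↑DX) ∉ {η : BondConfig V | c ∉ cl η.toFinset h₀ ∧ h₁ ∉ cl η.toFinset h₀ ∧ h₁ ∉ cl η.toFinset c ∧ Sep DX (cl η.toFinset h₀) c h₁ ∧ Sep DX (cl η.toFinset h₁) c h₀} := fun h => h.1 c1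
      rw [ind_of_mem hS, ind_of_not_mem nB, ind_of_not_mem nC, ind_of_not_mem nD, ind_of_not_mem nE, ind_of_not_mem nF, ind_of_not_mem nG, ind_of_not_mem nH]
      have hpow := powJ (hglue.2 (Or.inl hJ))
      by_cases hEv : insert s(h₀, h₁) (ω \ ↑DX) ∈ FA
      · have h1 : (ω \ ↑DX) ∈ {η : BondConfig V | insert s(h₀, h₁) η ∈ FA} := hEv
        rw [ind_of_mem h1, ind_of_mem ((hA ω hω hS).2 hEv)]
        unfold rcWeightW
        linear_combination (weight (fun e => (w e : ℝ)) ω) * hpow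
      · have h1 : (ω \ ↑DX) ∉ {η : BondConfig V | insert s(h₀, h₁) η ∈ FA} := hEv
        rw [ind_of_not_mem h1, ind_of_not_mem (fun h => hEv ((hA ω hω hS).1 h))]
        ring
    · -- state C
      have hS : (ω ∩ ↑DX) ∈ {η : BondConfig V | c ∈ cl η.toFinset h₀ ∧ h₁ ∉ cl η.toFinset h₀} := ⟨c1, hJ⟩
      have nA : (ω ∩ ↑DX) ∉ {η : BondConfig V | c ∈ cl η.toFinset h₀ ∧ h₁ ∈ cl η.toFinset h₀} := fun h => hJ h.2
      have nB : (ω ∩ ↑DX) ∉ {η : BondConfig V | c ∉ cl η.toFinset h₀ ∧ h₁ ∈ cl η.toFinset h₀} := fun h => h.1 c1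
      have nD : (ω ∩ ↑DX) ∉ {η : BondConfig V | c ∉ cl η.toFinset h₀ ∧ h₁ ∉ cl η.toFinset h₀ ∧ h₁ ∈ cl η.toFinset c} := fun h => h.1 c1
      have nE : (ω ∩ ↑DX) ∉ {η : BondConfig V | c ∉ cl η.toFinset h₀ ∧ h₁ ∉ cl η.toFinset h₀ ∧ h₁ ∉ cl η.toFinset c ∧ ¬ Sep DX (cl η.toFinset h₀) c h₁ ∧ ¬ Sep DX (cl η.toFinset h₁) c h₀} := fun h => h.1 c1
      have nF : (ω ∩ ↑DX) ∉ {η : BondConfig V | c ∉ cl η.toFinset h₀ ∧ h₁ ∉ cl η.toFinset h₀ ∧ h₁ ∉ cl η.toFinset c ∧ Sep DX (cl η.toFinset h₀) c h₁ ∧ ¬ Sep DX (cl η.toFinset h₁) c h₀} := fun h => h.1 c1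
      have nG : (ω ∩ ↑DX) ∉ {η : BondConfig V | c ∉ cl η.toFinset h₀ ∧ h₁ ∉ cl η.toFinset h₀ ∧ h₁ ∉ cl η.toFinset c ∧ ¬ Sep DX (cl η.toFinset h₀) c h₁ ∧ Sep DX (cl η.toFinset h₁) c h₀} := fun h => h.1 c1
      have nH : (ω ∩ ↑DX) ∉ {η : BondConfig V | c ∉ cl η.toFinset h₀ ∧ h₁ ∉ cl η.toFinset h₀ ∧ h₁ ∉ cl η.toFinset c ∧ Sep DX (cl η.toFinset h₀) c h₁ ∧ Sep DX (cl η.toFinset h₁) c h₀} := fun h => h.1 c1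
      rw [ind_of_mem hS, ind_of_not_mem nA, ind_of_not_mem nB, ind_of_not_mem nD, ind_of_not_mem nE, ind_of_not_mem nF, ind_of_not_mem nG, ind_of_not_mem nH]
      by_cases hJY : (ω \ ↑DX) ∈ {η : BondConfig V | h₁ ∈ cl η.toFinset h₀}
      · have hpow := powJ (hglue.2 (Or.inr hJY))
        rw [if_pos hJY]
        by_cases hEv : (ω \ ↑DX) ∈ FC
        · rw [ind_of_mem hEv, ind_of_mem ((hC ω hω hS).2 hEv)]
          unfold rcWeightW
          linear_combination (weight (fun e => (w e : ℝ)) ω) * hpow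
        · rw [ind_of_not_mem hEv, ind_of_not_mem (fun h => hEv ((hC ω hω hS).1 h))]
          ring
      · have hpow := powN (fun h => (hglue.1 h).elim hJ hJY)
        rw [if_neg hJY]
        by_cases hEv : (ω \ ↑DX) ∈ FC
        · rw [ind_of_mem hEv, ind_of_mem ((hC ω hω hS).2 hEv)]
          unfold rcWeightW
          linear_combination (weight (fun e => (w e : ℝ)) ω) * hpow
        · rw [ind_of_not_mem hEv, ind_of_not_mem (fun h => hEv ((hC ω hω hS).1 h))]
          ring
  · by_cases hJ : (ω ∩ ↑DX) ∈ {η : BondConfig V | h₁ ∈ cl η.toFinset h₀}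
    · -- state B
      have hS : (ω ∩ ↑DX) ∈ {η : BondConfig V | c ∉ cl η.toFinset h₀ ∧ h₁ ∈ cl η.toFinset h₀} := ⟨c1, hJ⟩
      have nA : (ω ∩ ↑DX) ∉ {η : BondConfig V | c ∈ cl η.toFinset h₀ ∧ h₁ ∈ cl η.toFinset h₀} := fun h => c1 h.1
      have nC : (ω ∩ ↑DX) ∉ {η : BondConfig V | c ∈ cl η.toFinset h₀ ∧ h₁ ∉ cl η.toFinset h₀} := fun h => c1 h.1
      have nD : (ω ∩ ↑DX) ∉ {η : BondConfig V | c ∉ cl η.toFinset h₀ ∧ h₁ ∉ cl η.toFinset h₀ ∧ h₁ ∈ cl η.toFinset c} := fun h => h.2.1 hJ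
      have nE : (ω ∩ ↑DX) ∉ {η : BondConfig V | c ∉ cl η.toFinset h₀ ∧ h₁ ∉ cl η.toFinset h₀ ∧ h₁ ∉ cl η.toFinset c ∧ ¬ Sep DX (cl η.toFinset h₀) c h₁ ∧ ¬ Sep DX (cl η.toFinset h₁) c h₀} := fun h => h.2.1 hJ
      have nF : (ω ∩ ↑DX) ∉ {η : BondConfig V | c ∉ cl η.toFinset h₀ ∧ h₁ ∉ cl η.toFinset h₀ ∧ h₁ ∉ cl η.toFinset c ∧ Sep DX (cl η.toFinset h₀) c h₁ ∧ ¬ Sep DX (cl η.toFinset h₁) c h₀} := fun h => h.2.1 hJ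
      have nG : (ω ∩ ↑DX) ∉ {η : BondConfig V | c ∉ cl η.toFinset h₀ ∧ h₁ ∉ cl η.toFinset h₀ ∧ h₁ ∉ cl η.toFinset c ∧ ¬ Sep DX (cl η.toFinset h₀) c h₁ ∧ Sep DX (cl η.toFinset h₁) c h₀} := fun h => h.2.1 hJ
      have nH : (ω ∩ ↑DX) ∉ {η : BondConfig V | c ∉ cl η.toFinset h₀ ∧ h₁ ∉ cl η.toFinset h₀ ∧ h₁ ∉ cl η.toFinset c ∧ Sep DX (cl η.toFinset h₀) c h₁ ∧ Sep DX (cl η.toFinset h₁) c h₀} := fun h => h.2.1 hJ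
      rw [ind_of_mem hS, ind_of_not_mem nA, ind_of_not_mem nC, ind_of_not_mem nD, ind_of_not_mem nE, ind_of_not_mem nF, ind_of_not_mem nG, ind_of_not_mem nH]
      have hpow := powJ (hglue.2 (Or.inl hJ))
      by_cases hEv : insert s(h₀, h₁) (ω \ ↑DX) ∈ FB
      · have h1 : (ω \ ↑DX) ∈ {η : BondConfig V | insert s(h₀, h₁) η ∈ FB} := hEv
        rw [ind_of_mem h1, ind_of_mem ((hB ω hω hS).2 hEv)]
        unfold rcWeightW
        linear_combination (weight (fun e => (w e : ℝ)) ω) * hpow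
      · have h1 : (ω \ ↑DX) ∉ {η : BondConfig V | insert s(h₀, h₁) η ∈ FB} := hEv
        rw [ind_of_not_mem h1, ind_of_not_mem (fun h => hEv ((hB ω hω hS).1 h))]
        ring
    · by_cases c2 : (ω ∩ ↑DX) ∈ {η : BondConfig V | h₁ ∈ cl η.toFinset c}
      · -- state D
        have hS : (ω ∩ ↑DX) ∈ {η : BondConfig V | c ∉ cl η.toFinset h₀ ∧ h₁ ∉ cl η.toFinset h₀ ∧ h₁ ∈ cl η.toFinset c} := ⟨c1, hJ, c2⟩
        have nA : (ω ∩ ↑DX) ∉ {η : BondConfig V | c ∈ cl η.toFinset h₀ ∧ h₁ ∈ cl η.toFinset h₀} := fun h => c1 h.1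
        have nB : (ω ∩ ↑DX) ∉ {η : BondConfig V | c ∉ cl η.toFinset h₀ ∧ h₁ ∈ cl η.toFinset h₀} := fun h => hJ h.2
        have nC : (ω ∩ ↑DX) ∉ {η : BondConfig V | c ∈ cl η.toFinset h₀ ∧ h₁ ∉ cl η.toFinset h₀} := fun h => c1 h.1
        have nE : (ω ∩ ↑DX) ∉ {η : BondConfig V | c ∉ cl η.toFinset h₀ ∧ h₁ ∉ cl η.toFinset h₀ ∧ h₁ ∉ cl η.toFinset c ∧ ¬ Sep DX (cl η.toFinset h₀) c h₁ ∧ ¬ Sep DX (cl η.toFinset h₁) c h₀} := fun h => h.2.2.1 c2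
        have nF : (ω ∩ ↑DX) ∉ {η : BondConfig V | c ∉ cl η.toFinset h₀ ∧ h₁ ∉ cl η.toFinset h₀ ∧ h₁ ∉ cl η.toFinset c ∧ Sep DX (cl η.toFinset h₀) c h₁ ∧ ¬ Sep DX (cl η.toFinset h₁) c h₀} := fun h => h.2.2.1 c2
        have nG : (ω ∩ ↑DX) ∉ {η : BondConfig V | c ∉ cl η.toFinset h₀ ∧ h₁ ∉ cl η.toFinset h₀ ∧ h₁ ∉ cl η.toFinset c ∧ ¬ Sep DX (cl η.toFinset h₀) c h₁ ∧ Sep DX (cl η.toFinset h₁) c h₀} := fun h => h.2.2.1 c2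
        have nH : (ω ∩ ↑DX) ∉ {η : BondConfig V | c ∉ cl η.toFinset h₀ ∧ h₁ ∉ cl η.toFinset h₀ ∧ h₁ ∉ cl η.toFinset c ∧ Sep DX (cl η.toFinset h₀) c h₁ ∧ Sep DX (cl η.toFinset h₁) c h₀} := fun h => h.2.2.1 c2
        rw [ind_of_mem hS, ind_of_not_mem nA, ind_of_not_mem nB, ind_of_not_mem nC, ind_of_not_mem nE, ind_of_not_mem nF, ind_of_not_mem nG, ind_of_not_mem nH]
        by_cases hJY : (ω \ ↑DX) ∈ {η : BondConfig V | h₁ ∈ cl η.toFinset h₀}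
        · have hpow := powJ (hglue.2 (Or.inr hJY))
          rw [if_pos hJY]
          by_cases hEv : (ω \ ↑DX) ∈ FD
          · rw [ind_of_mem hEv, ind_of_mem ((hD ω hω hS).2 hEv)]
            unfold rcWeightW
            linear_combination (weight (fun e => (w e : ℝ)) ω) * hpow
          · rw [ind_of_not_mem hEv, ind_of_not_mem (fun h => hEv ((hD ω hω hS).1 h))]
            ring
        · have hpow := powN (fun h => (hglue.1 h).elim hJ hJY)
          rw [if_neg hJY]
          by_cases hEv : (ω \ ↑DX) ∈ FD
          · rw [ind_of_mem hEv, ind_of_mem ((hD ω hω hS).2 hEv)]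
            unfold rcWeightW
            linear_combination (weight (fun e => (w e : ℝ)) ω) * hpow
          · rw [ind_of_not_mem hEv, ind_of_not_mem (fun h => hEv ((hD ω hω hS).1 h))]
            ring
      · by_cases n0 : (ω ∩ ↑DX) ∈ {η : BondConfig V | Sep DX (cl η.toFinset h₀) c h₁}
        · by_cases n1 : (ω ∩ ↑DX) ∈ {η : BondConfig V | Sep DX (cl η.toFinset h₁) c h₀}
          · -- state H (N₀, N₁)
            have hS : (ω ∩ ↑DX) ∈ {η : BondConfig V | c ∉ cl η.toFinset h₀ ∧ h₁ ∉ cl η.toFinset h₀ ∧ h₁ ∉ cl η.toFinset c ∧ Sep DX (cl η.toFinset h₀) c h₁ ∧ Sep DX (cl η.toFinset h₁) c h₀} := ⟨c1, hJ, c2, n0, n1⟩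
            have nA : (ω ∩ ↑DX) ∉ {η : BondConfig V | c ∈ cl η.toFinset h₀ ∧ h₁ ∈ cl η.toFinset h₀} := fun h => c1 h.1
            have nB : (ω ∩ ↑DX) ∉ {η : BondConfig V | c ∉ cl η.toFinset h₀ ∧ h₁ ∈ cl η.toFinset h₀} := fun h => hJ h.2
            have nC : (ω ∩ ↑DX) ∉ {η : BondConfig V | c ∈ cl η.toFinset h₀ ∧ h₁ ∉ cl η.toFinset h₀} := fun h => c1 h.1
            have nD : (ω ∩ ↑DX) ∉ {η : BondConfig V | c ∉ cl η.toFinset h₀ ∧ h₁ ∉ cl η.toFinset h₀ ∧ h₁ ∈ cl η.toFinset c} := fun h => c2 h.2.2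
            have nE : (ω ∩ ↑DX) ∉ {η : BondConfig V | c ∉ cl η.toFinset h₀ ∧ h₁ ∉ cl η.toFinset h₀ ∧ h₁ ∉ cl η.toFinset c ∧ ¬ Sep DX (cl η.toFinset h₀) c h₁ ∧ ¬ Sep DX (cl η.toFinset h₁) c h₀} := fun h => h.2.2.2.1 n0
            have nF : (ω ∩ ↑DX) ∉ {η : BondConfig V | c ∉ cl η.toFinset h₀ ∧ h₁ ∉ cl η.toFinset h₀ ∧ h₁ ∉ cl η.toFinset c ∧ Sep DX (cl η.toFinset h₀) c h₁ ∧ ¬ Sep DX (cl η.toFinset h₁) c h₀} := fun h => h.2.2.2.2 n1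
            have nG : (ω ∩ ↑DX) ∉ {η : BondConfig V | c ∉ cl η.toFinset h₀ ∧ h₁ ∉ cl η.toFinset h₀ ∧ h₁ ∉ cl η.toFinset c ∧ ¬ Sep DX (cl η.toFinset h₀) c h₁ ∧ Sep DX (cl η.toFinset h₁) c h₀} := fun h => h.2.2.2.1 n0
            rw [ind_of_mem hS, ind_of_not_mem nA, ind_of_not_mem nB, ind_of_not_mem nC, ind_of_not_mem nD, ind_of_not_mem nE, ind_of_not_mem nF, ind_of_not_mem nG]
            by_cases hJY : (ω \ ↑DX) ∈ {η : BondConfig V | h₁ ∈ cl η.toFinset h₀}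
            · have hpow := powJ (hglue.2 (Or.inr hJY))
              rw [if_pos hJY]
              by_cases hEv : (ω \ ↑DX) ∈ FH
              · rw [ind_of_mem hEv, ind_of_mem ((hH ω hω hS).2 hEv)]
                unfold rcWeightW
                linear_combination (weight (fun e => (w e : ℝ)) ω) * hpow
              · rw [ind_of_not_mem hEv, ind_of_not_mem (fun h => hEv ((hH ω hω hS).1 h))]
                ring
            · have hpow := powN (fun h => (hglue.1 h).elim hJ hJY)
              rw [if_neg hJY]
              by_cases hEv : (ω \ ↑DX) ∈ FH
              · rw [ind_of_mem hEv, ind_of_mem ((hH ω hω hS).2 hEv)]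
                unfold rcWeightW
                linear_combination (weight (fun e => (w e : ℝ)) ω) * hpow
              · rw [ind_of_not_mem hEv, ind_of_not_mem (fun h => hEv ((hH ω hω hS).1 h))]
                ring
          · -- state F (N₀, ¬N₁)
            have hS : (ω ∩ ↑DX) ∈ {η : BondConfig V | c ∉ cl η.toFinset h₀ ∧ h₁ ∉ cl η.toFinset h₀ ∧ h₁ ∉ cl η.toFinset c ∧ Sep DX (cl η.toFinset h₀) c h₁ ∧ ¬ Sep DX (cl η.toFinset h₁) c h₀} := ⟨c1, hJ, c2, n0, n1⟩
            have nA : (ω ∩ ↑DX) ∉ {η : BondConfig V | c ∈ cl η.toFinset h₀ ∧ h₁ ∈ cl η.toFinset h₀} := fun h => c1 h.1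
            have nB : (ω ∩ ↑DX) ∉ {η : BondConfig V | c ∉ cl η.toFinset h₀ ∧ h₁ ∈ cl η.toFinset h₀} := fun h => hJ h.2
            have nC : (ω ∩ ↑DX) ∉ {η : BondConfig V | c ∈ cl η.toFinset h₀ ∧ h₁ ∉ cl η.toFinset h₀} := fun h => c1 h.1
            have nD : (ω ∩ ↑DX) ∉ {η : BondConfig V | c ∉ cl η.toFinset h₀ ∧ h₁ ∉ cl η.toFinset h₀ ∧ h₁ ∈ cl η.toFinset c} := fun h => c2 h.2.2
            have nE : (ω ∩ ↑DX) ∉ {η : BondConfig V | c ∉ cl η.toFinset h₀ ∧ h₁ ∉ cl η.toFinset h₀ ∧ h₁ ∉ cl η.toFinset c ∧ ¬ Sep DX (cl η.toFinset h₀) c h₁ ∧ ¬ Sep DX (cl η.toFinset h₁) c h₀} := fun h => h.2.2.2.1 n0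
            have nG : (ω ∩ ↑DX) ∉ {η : BondConfig V | c ∉ cl η.toFinset h₀ ∧ h₁ ∉ cl η.toFinset h₀ ∧ h₁ ∉ cl η.toFinset c ∧ ¬ Sep DX (cl η.toFinset h₀) c h₁ ∧ Sep DX (cl η.toFinset h₁) c h₀} := fun h => h.2.2.2.1 n0
            have nH : (ω ∩ ↑DX) ∉ {η : BondConfig V | c ∉ cl η.toFinset h₀ ∧ h₁ ∉ cl η.toFinset h₀ ∧ h₁ ∉ cl η.toFinset c ∧ Sep DX (cl η.toFinset h₀) c h₁ ∧ Sep DX (cl η.toFinset h₁) c h₀} := fun h => n1 h.2.2.2.2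
            rw [ind_of_mem hS, ind_of_not_mem nA, ind_of_not_mem nB, ind_of_not_mem nC, ind_of_not_mem nD, ind_of_not_mem nE, ind_of_not_mem nG, ind_of_not_mem nH]
            by_cases hJY : (ω \ ↑DX) ∈ {η : BondConfig V | h₁ ∈ cl η.toFinset h₀}
            · have hpow := powJ (hglue.2 (Or.inr hJY))
              rw [if_pos hJY]
              by_cases hEv : (ω \ ↑DX) ∈ FF
              · rw [ind_of_mem hEv, ind_of_mem ((hF ω hω hS).2 hEv)]
                unfold rcWeightW
                linear_combination (weight (fun e => (w e : ℝ)) ω) * hpow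
              · rw [ind_of_not_mem hEv, ind_of_not_mem (fun h => hEv ((hF ω hω hS).1 h))]
                ring
            · have hpow := powN (fun h => (hglue.1 h).elim hJ hJY)
              rw [if_neg hJY]
              by_cases hEv : (ω \ ↑DX) ∈ FF
              · rw [ind_of_mem hEv, ind_of_mem ((hF ω hω hS).2 hEv)]
                unfold rcWeightW
                linear_combination (weight (fun e => (w e : ℝ)) ω) * hpow
              · rw [ind_of_not_mem hEv, ind_of_not_mem (fun h => hEv ((hF ω hω hS).1 h))]
                ring
        · by_cases n1 : (ω ∩ ↑DX) ∈ {η : BondConfig V | Sep DX (cl η.toFinset h₁) c h₀}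
          · -- state G (¬N₀, N₁)
            have hS : (ω ∩ ↑DX) ∈ {η : BondConfig V | c ∉ cl η.toFinset h₀ ∧ h₁ ∉ cl η.toFinset h₀ ∧ h₁ ∉ cl η.toFinset c ∧ ¬ Sep DX (cl η.toFinset h₀) c h₁ ∧ Sep DX (cl η.toFinset h₁) c h₀} := ⟨c1, hJ, c2, n0, n1⟩
            have nA : (ω ∩ ↑DX) ∉ {η : BondConfig V | c ∈ cl η.toFinset h₀ ∧ h₁ ∈ cl η.toFinset h₀} := fun h => c1 h.1
            have nB : (ω ∩ ↑DX) ∉ {η : BondConfig V | c ∉ cl η.toFinset h₀ ∧ h₁ ∈ cl η.toFinset h₀} := fun h => hJ h.2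
            have nC : (ω ∩ ↑DX) ∉ {η : BondConfig V | c ∈ cl η.toFinset h₀ ∧ h₁ ∉ cl η.toFinset h₀} := fun h => c1 h.1
            have nD : (ω ∩ ↑DX) ∉ {η : BondConfig V | c ∉ cl η.toFinset h₀ ∧ h₁ ∉ cl η.toFinset h₀ ∧ h₁ ∈ cl η.toFinset c} := fun h => c2 h.2.2
            have nE : (ω ∩ ↑DX) ∉ {η : BondConfig V | c ∉ cl η.toFinset h₀ ∧ h₁ ∉ cl η.toFinset h₀ ∧ h₁ ∉ cl η.toFinset c ∧ ¬ Sep DX (cl η.toFinset h₀) c h₁ ∧ ¬ Sep DX (cl η.toFinset h₁) c h₀} := fun h => h.2.2.2.2 n1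
            have nF : (ω ∩ ↑DX) ∉ {η : BondConfig V | c ∉ cl η.toFinset h₀ ∧ h₁ ∉ cl η.toFinset h₀ ∧ h₁ ∉ cl η.toFinset c ∧ Sep DX (cl η.toFinset h₀) c h₁ ∧ ¬ Sep DX (cl η.toFinset h₁) c h₀} := fun h => n0 h.2.2.2.1
            have nH : (ω ∩ ↑DX) ∉ {η : BondConfig V | c ∉ cl η.toFinset h₀ ∧ h₁ ∉ cl η.toFinset h₀ ∧ h₁ ∉ cl η.toFinset c ∧ Sep DX (cl η.toFinset h₀) c h₁ ∧ Sep DX (cl η.toFinset h₁) c h₀} := fun h => n0 h.2.2.2.1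
            rw [ind_of_mem hS, ind_of_not_mem nA, ind_of_not_mem nB, ind_of_not_mem nC, ind_of_not_mem nD, ind_of_not_mem nE, ind_of_not_mem nF, ind_of_not_mem nH]
            by_cases hJY : (ω \ ↑DX) ∈ {η : BondConfig V | h₁ ∈ cl η.toFinset h₀}
            · have hpow := powJ (hglue.2 (Or.inr hJY))
              rw [if_pos hJY]
              by_cases hEv : (ω \ ↑DX) ∈ FG
              · rw [ind_of_mem hEv, ind_of_mem ((hG ω hω hS).2 hEv)]
                unfold rcWeightW
                linear_combination (weight (fun e => (w e : ℝ)) ω) * hpow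
              · rw [ind_of_not_mem hEv, ind_of_not_mem (fun h => hEv ((hG ω hω hS).1 h))]
                ring
            · have hpow := powN (fun h => (hglue.1 h).elim hJ hJY)
              rw [if_neg hJY]
              by_cases hEv : (ω \ ↑DX) ∈ FG
              · rw [ind_of_mem hEv, ind_of_mem ((hG ω hω hS).2 hEv)]
                unfold rcWeightW
                linear_combination (weight (fun e => (w e : ℝ)) ω) * hpow
              · rw [ind_of_not_mem hEv, ind_of_not_mem (fun h => hEv ((hG ω hω hS).1 h))]
                ring
          · -- state E (¬N₀, ¬N₁)
            have hS : (ω ∩ ↑DX) ∈ {η : BondConfig V | c ∉ cl η.toFinset h₀ ∧ h₁ ∉ cl η.toFinset h₀ ∧ h₁ ∉ cl η.toFinset c ∧ ¬ Sep DX (cl η.toFinset h₀) c h₁ ∧ ¬ Sep DX (cl η.toFinset h₁) c h₀} := ⟨c1, hJ, c2, n0, n1⟩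
            have nA : (ω ∩ ↑DX) ∉ {η : BondConfig V | c ∈ cl η.toFinset h₀ ∧ h₁ ∈ cl η.toFinset h₀} := fun h => c1 h.1
            have nB : (ω ∩ ↑DX) ∉ {η : BondConfig V | c ∉ cl η.toFinset h₀ ∧ h₁ ∈ cl η.toFinset h₀} := fun h => hJ h.2
            have nC : (ω ∩ ↑DX) ∉ {η : BondConfig V | c ∈ cl η.toFinset h₀ ∧ h₁ ∉ cl η.toFinset h₀} := fun h => c1 h.1
            have nD : (ω ∩ ↑DX) ∉ {η : BondConfig V | c ∉ cl η.toFinset h₀ ∧ h₁ ∉ cl η.toFinset h₀ ∧ h₁ ∈ cl η.toFinset c} := fun h => c2 h.2.2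
            have nF : (ω ∩ ↑DX) ∉ {η : BondConfig V | c ∉ cl η.toFinset h₀ ∧ h₁ ∉ cl η.toFinset h₀ ∧ h₁ ∉ cl η.toFinset c ∧ Sep DX (cl η.toFinset h₀) c h₁ ∧ ¬ Sep DX (cl η.toFinset h₁) c h₀} := fun h => n0 h.2.2.2.1
            have nG : (ω ∩ ↑DX) ∉ {η : BondConfig V | c ∉ cl η.toFinset h₀ ∧ h₁ ∉ cl η.toFinset h₀ ∧ h₁ ∉ cl η.toFinset c ∧ ¬ Sep DX (cl η.toFinset h₀) c h₁ ∧ Sep DX (cl η.toFinset h₁) c h₀} := fun h => n1 h.2.2.2.2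
            have nH : (ω ∩ ↑DX) ∉ {η : BondConfig V | c ∉ cl η.toFinset h₀ ∧ h₁ ∉ cl η.toFinset h₀ ∧ h₁ ∉ cl η.toFinset c ∧ Sep DX (cl η.toFinset h₀) c h₁ ∧ Sep DX (cl η.toFinset h₁) c h₀} := fun h => n0 h.2.2.2.1
            rw [ind_of_mem hS, ind_of_not_mem nA, ind_of_not_mem nB, ind_of_not_mem nC, ind_of_not_mem nD, ind_of_not_mem nF, ind_of_not_mem nG, ind_of_not_mem nH]
            by_cases hJY : (ω \ ↑DX) ∈ {η : BondConfig V | h₁ ∈ cl η.toFinset h₀}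
            · have hpow := powJ (hglue.2 (Or.inr hJY))
              rw [if_pos hJY]
              by_cases hEv : (ω \ ↑DX) ∈ FE
              · rw [ind_of_mem hEv, ind_of_mem ((hE ω hω hS).2 hEv)]
                unfold rcWeightW
                linear_combination (weight (fun e => (w e : ℝ)) ω) * hpow
              · rw [ind_of_not_mem hEv, ind_of_not_mem (fun h => hEv ((hE ω hω hS).1 h))]
                ring
            · have hpow := powN (fun h => (hglue.1 h).elim hJ hJY)
              rw [if_neg hJY]
              by_cases hEv : (ω \ ↑DX) ∈ FE
              · rw [ind_of_mem hEv, ind_of_mem ((hE ω hω hS).2 hEv)]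
                unfold rcWeightW
                linear_combination (weight (fun e => (w e : ℝ)) ω) * hpow
              · rw [ind_of_not_mem hEv, ind_of_not_mem (fun h => hEv ((hE ω hω hS).1 h))]
                ring

end Pointwise

section Sums

variable {DX DK : Finset (Sym2 V)} {h₀ h₁ c : V} (h01 : h₀ ≠ h₁)
  (hsepD : ∀ z : V, (∃ e ∈ DX, z ∈ e) → (∃ e ∈ DK, z ∈ e) → (z = h₀ ∨ z = h₁))
  (w wX wK : Sym2 V → unitInterval) {q : ℝ} (hw : ∀ e, e ∉ (↑DX ∪ ↑DK : Set (Sym2 V)) → (w e : ℝ) = 0)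
  (hX : ∀ e ∈ (↑DX : Set (Sym2 V)), wX e = w e) (hX' : ∀ e ∉ (↑DX : Set (Sym2 V)), wX e = 0)
  (hY : ∀ e ∈ (↑DX : Set (Sym2 V)), wK e = 0) (hY' : ∀ e ∉ (↑DX : Set (Sym2 V)), wK e = w e)
include h01 hsepD hw hX hX' hY hY'

/-- **The dictionary**: `K · Zφ(E_G) = Σ_s X_s · R_s` over the eight arm states. [this work] -/
theorem sum_eq {EG FA FB FC FD FE FF FG FH : Set (BondConfig V)}
    (hA : (∀ ω : BondConfig V, ω ⊆ ↑DX ∪ ↑DK → (ω ∩ ↑DX) ∈ {η : BondConfig V | c ∈ cl η.toFinset h₀ ∧ h₁ ∈ cl η.toFinset h₀} → (ω ∈ EG ↔ insert s(h₀, h₁) (ω \ ↑DX) ∈ FA))) (hB : (∀ ω : BondConfig V, ω ⊆ ↑DX ∪ ↑DK → (ω ∩ ↑DX) ∈ {η : BondConfig V | c ∉ cl η.toFinset h₀ ∧ h₁ ∈ cl η.toFinset h₀} → (ω ∈ EG ↔ insert s(h₀, h₁) (ω \ ↑DX) ∈ FB))) (hC : (∀ ω : BondConfig V, ω ⊆ ↑DX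 ∪ ↑DK → (ω ∩ ↑DX) ∈ {η : BondConfig V | c ∈ cl η.toFinset h₀ ∧ h₁ ∉ cl η.toFinset h₀} → (ω ∈ EG ↔ (ω \ ↑DX) ∈ FC))) (hD : (∀ ω : BondConfig V, ω ⊆ ↑DX ∪ ↑DK → (ω ∩ ↑DX) ∈ {η : BondConfig V | c ∉ cl η.toFinset h₀ ∧ h₁ ∉ cl η.toFinset h₀ ∧ h₁ ∈ cl η.toFinset c} → (ω ∈ EG ↔ (ω \ ↑DX) ∈ FD))) (hE : (∀ ω : BondConfig V, ω ⊆ ↑DX ∪ ↑DK → (ω ∩ ↑DX) ∈ {η : BondConfig V | c ∉ cl η.toFinset h₀ ∧ h₁ ∉ cl η.toFinset h₀ ∧ h₁ ∉ cl η.toFinset c ∧ ¬ Sep DX (cl η.toFinset h₀) c h₁ ∧ ¬ Sep DX (cl η.toFinset h₁) c h₀} → (ω ∈ EG ↔ (ω \ ↑DX) ∈ FE))) (hF : (∀ ω : BondConfig V, ω ⊆ ↑DX ∪ ↑DK → (ω ∩ ↑DX) ∈ {η : BondConfig V | c ∉ cl η.toFinset h₀ ∧ h₁ ∉ cl η.toFinset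 h₀ ∧ h₁ ∉ cl η.toFinset c ∧ Sep DX (cl η.toFinset h₀) c h₁ ∧ ¬ Sep DX (cl η.toFinset h₁) c h₀} → (ω ∈ EG ↔ (ω \ ↑DX) ∈ FF))) (hG : (∀ ω : BondConfig V, ω ⊆ ↑DX ∪ ↑DK → (ω ∩ ↑DX) ∈ {η : BondConfig V | c ∉ cl η.toFinset h₀ ∧ h₁ ∉ cl η.toFinset h₀ ∧ h₁ ∉ cl η.toFinset c ∧ ¬ Sep DX (cl η.toFinset h₀) c h₁ ∧ Sep DX (cl η.toFinset h₁) c h₀} → (ω ∈ EG ↔ (ω \ ↑DX) ∈ FG))) (hH : (∀ ω : BondConfig V, ω ⊆ ↑DX ∪ ↑DK → (ω ∩ ↑DX) ∈ {η : BondConfig V | c ∉ cl η.toFinset h₀ ∧ h₁ ∉ cl η.toFinset h₀ ∧ h₁ ∉ cl η.toFinset c ∧ Sep DX (cl η.toFinset h₀) c h₁ ∧ Sep DX (cl η.toFinset h₁) c h₀} → (ω ∈ EG ↔ (ω \ ↑DX) ∈ FH))) :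
    (∑ ω : BondConfig V, rcWeightW w q ∅ ω * ind EG ω) * q ^ clusterCount (∅ : BondConfig V) ({h₀, h₁} : Set V) =
      (∑ η : BondConfig V, rcWeightW wX q ({h₀, h₁} : Set V) η * ind {η : BondConfig V | c ∈ cl η.toFinset h₀ ∧ h₁ ∈ cl η.toFinset h₀} η) * (∑ η : BondConfig V, rcWeightW wK q ({h₀, h₁} : Set V) η * ind {η : BondConfig V | insert s(h₀, h₁) η ∈ FA} η) + (∑ η : BondConfig V, rcWeightW wX q ({h₀, h₁} : Set V) η * ind {η : BondConfig V | c ∉ cl η.toFinset h₀ ∧ h₁ ∈ cl η.toFinset h₀} η) * (∑ η : BondConfig V, rcWeightW wK q ({h₀, h₁} : Set V) η * ind {η : BondConfig V | insert s(h₀, h₁) η ∈ FB} η) + (∑ η : BondConfig V, rcWeightW wX q ({h₀, h₁} : Set V) η * ind {η : BondConfig V | c ∈ cl η.toFinset h₀ ∧ h₁ ∉ cl η.toFinset h₀} η) * (∑ η : BondConfig V, rcWeightW wK q ({h₀, h₁} : Set V) η * (ind FC η * (if η ∈ {η : BondConfig V | h₁ ∈ cl η.toFinset h₀} then 1 else q)))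 + (∑ η : BondConfig V, rcWeightW wX q ({h₀, h₁} : Set V) η * ind {η : BondConfig V | c ∉ cl η.toFinset h₀ ∧ h₁ ∉ cl η.toFinset h₀ ∧ h₁ ∈ cl η.toFinset c} η) * (∑ η : BondConfig V, rcWeightW wK q ({h₀, h₁} : Set V) η * (ind FD η * (if η ∈ {η : BondConfig V | h₁ ∈ cl η.toFinset h₀} then 1 else q))) + (∑ η : BondConfig V, rcWeightW wX q ({h₀, h₁} : Set V) η * ind {η : BondConfig V | c ∉ cl η.toFinset h₀ ∧ h₁ ∉ cl η.toFinset h₀ ∧ h₁ ∉ cl η.toFinset c ∧ ¬ Sep DX (cl η.toFinset h₀) c h₁ ∧ ¬ Sep DX (cl η.toFinset h₁) c h₀} η) * (∑ η : BondConfig V, rcWeightW wK q ({h₀, h₁} : Set V) η * (ind FE η * (if η ∈ {η : BondConfig V | h₁ ∈ cl η.toFinset h₀} then 1 else q))) + (∑ η : BondConfig V, rcWeightW wX q ({h₀, h₁} : Set V) η * ind {η : BondConfig V | c ∉ cl η.toFinset h₀ ∧ h₁ ∉ cl η.toFinset h₀ ∧ h₁ ∉ cl η.toFinset c ∧ Sep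 DX (cl η.toFinset h₀) c h₁ ∧ ¬ Sep DX (cl η.toFinset h₁) c h₀} η) * (∑ η : BondConfig V, rcWeightW wK q ({h₀, h₁} : Set V) η * (ind FF η * (if η ∈ {η : BondConfig V | h₁ ∈ cl η.toFinset h₀} then 1 else q))) + (∑ η : BondConfig V, rcWeightW wX q ({h₀, h₁} : Set V) η * ind {η : BondConfig V | c ∉ cl η.toFinset h₀ ∧ h₁ ∉ cl η.toFinset h₀ ∧ h₁ ∉ cl η.toFinset c ∧ ¬ Sep DX (cl η.toFinset h₀) c h₁ ∧ Sep DX (cl η.toFinset h₁) c h₀} η) * (∑ η : BondConfig V, rcWeightW wK q ({h₀, h₁} : Set V) η * (ind FG η * (if η ∈ {η : BondConfig V | h₁ ∈ cl η.toFinset h₀} then 1 else q))) + (∑ η : BondConfig V, rcWeightW wX q ({h₀, h₁} : Set V) η * ind {η : BondConfig V | c ∉ cl η.toFinset h₀ ∧ h₁ ∉ cl η.toFinset h₀ ∧ h₁ ∉ cl η.toFinset c ∧ Sep DX (cl η.toFinset h₀) c h₁ ∧ Sep DX (cl η.toFinset h₁) c h₀} η) * (∑ η : BondConfig V, rcWeightW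 wK q ({h₀, h₁} : Set V) η * (ind FH η * (if η ∈ {η : BondConfig V | h₁ ∈ cl η.toFinset h₀} then 1 else q))) := by
  rw [Finset.sum_mul, Finset.sum_congr rfl fun ω _ => pt h01 hsepD w q hw hA hB hC hD hE hF hG hH ω]
  simp only [mul_add]
  rw [Finset.sum_add_distrib, Finset.sum_add_distrib, Finset.sum_add_distrib, Finset.sum_add_distrib, Finset.sum_add_distrib,
    Finset.sum_add_distrib, Finset.sum_add_distrib]
  have eA := ApexTwoSum.sum_weight_blocks_rc w wX wK (↑DX) hX hX' hY hY' q ({h₀, h₁} : Set V)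
    (fun x => ind {η : BondConfig V | c ∈ cl η.toFinset h₀ ∧ h₁ ∈ cl η.toFinset h₀} x) (fun y => ind {η : BondConfig V | insert s(h₀, h₁) η ∈ FA} y)
  have eB := ApexTwoSum.sum_weight_blocks_rc w wX wK (↑DX) hX hX' hY hY' q ({h₀, h₁} : Set V)
    (fun x => ind {η : BondConfig V | c ∉ cl η.toFinset h₀ ∧ h₁ ∈ cl η.toFinset h₀} x) (fun y => ind {η : BondConfig V | insert s(h₀, h₁) η ∈ FB} y)
  have eC := ApexTwoSum.sum_weight_blocks_rc w wX wK (↑DX) hX hX' hY hY' q ({h₀, h₁} : Set V)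
    (fun x => ind {η : BondConfig V | c ∈ cl η.toFinset h₀ ∧ h₁ ∉ cl η.toFinset h₀} x) (fun y => ind FC y * (if y ∈ {η : BondConfig V | h₁ ∈ cl η.toFinset h₀} then 1 else q))
  have eD := ApexTwoSum.sum_weight_blocks_rc w wX wK (↑DX) hX hX' hY hY' q ({h₀, h₁} : Set V)
    (fun x => ind {η : BondConfig V | c ∉ cl η.toFinset h₀ ∧ h₁ ∉ cl η.toFinset h₀ ∧ h₁ ∈ cl η.toFinset c} x) (fun y => ind FD y * (if y ∈ {η : BondConfig V | h₁ ∈ cl η.toFinset h₀} then 1 else q))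
  have eE := ApexTwoSum.sum_weight_blocks_rc w wX wK (↑DX) hX hX' hY hY' q ({h₀, h₁} : Set V)
    (fun x => ind {η : BondConfig V | c ∉ cl η.toFinset h₀ ∧ h₁ ∉ cl η.toFinset h₀ ∧ h₁ ∉ cl η.toFinset c ∧ ¬ Sep DX (cl η.toFinset h₀) c h₁ ∧ ¬ Sep DX (cl η.toFinset h₁) c h₀} x) (fun y => ind FE y * (if y ∈ {η : BondConfig V | h₁ ∈ cl η.toFinset h₀} then 1 else q))
  have eF := ApexTwoSum.sum_weight_blocks_rc w wX wK (↑DX) hX hX' hY hY' q ({h₀, h₁} : Set V)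
    (fun x => ind {η : BondConfig V | c ∉ cl η.toFinset h₀ ∧ h₁ ∉ cl η.toFinset h₀ ∧ h₁ ∉ cl η.toFinset c ∧ Sep DX (cl η.toFinset h₀) c h₁ ∧ ¬ Sep DX (cl η.toFinset h₁) c h₀} x) (fun y => ind FF y * (if y ∈ {η : BondConfig V | h₁ ∈ cl η.toFinset h₀} then 1 else q))
  have eG := ApexTwoSum.sum_weight_blocks_rc w wX wK (↑DX) hX hX' hY hY' q ({h₀, h₁} : Set V)
    (fun x => ind {η : BondConfig V | c ∉ cl η.toFinset h₀ ∧ h₁ ∉ cl η.toFinset h₀ ∧ h₁ ∉ cl η.toFinset c ∧ ¬ Sep DX (cl η.toFinset h₀) c h₁ ∧ Sep DX (cl η.toFinset h₁) c h₀} x) (fun y => ind FG y * (if y ∈ {η : BondConfig V | h₁ ∈ cl η.toFinset h₀} then 1 else q))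
  have eH := ApexTwoSum.sum_weight_blocks_rc w wX wK (↑DX) hX hX' hY hY' q ({h₀, h₁} : Set V)
    (fun x => ind {η : BondConfig V | c ∉ cl η.toFinset h₀ ∧ h₁ ∉ cl η.toFinset h₀ ∧ h₁ ∉ cl η.toFinset c ∧ Sep DX (cl η.toFinset h₀) c h₁ ∧ Sep DX (cl η.toFinset h₁) c h₀} x) (fun y => ind FH y * (if y ∈ {η : BondConfig V | h₁ ∈ cl η.toFinset h₀} then 1 else q))
  beta_reduce at eA eB eC eD eE eF eG eH
  rw [← eA, ← eB, ← eC, ← eD, ← eE, ← eF, ← eG, ← eH]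

end Sums

end HubPairTerm

end Summit.CriticalPhenomena.PercolationContinuityZ3.Theorems
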